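import Summits.QuantumFields.YangMills.Theorems.UniversalDetectorMeshArzelaAscoli
import Literature.MathematicalPhysics.QuantumLattice.LatticeScalarField

/-!
# Route `UniversalDetector`, support item `PlaneLimitExtraction` (stmt-QuantumFields-23251) — the diagonal
extraction of a continuum kernel from tight lattice kernels (lattice specialisation of the mesh Arzelà–Ascoli)

Ideator seat ym-idea-8 g7 (LINE 4 of rung R2a = `BalabanLadder.NT`).  The first three conclusions of
`PlaneLimitExtraction` — a subsequence `φ`, a limit kernel `K` with local uniform convergence of the rescaled
lattice kernels on every annulus `η ≤ ‖·‖ ≤ η⁻¹`, continuity of `K` off the origin, boundedness away from it — in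
exactly the item's quantifier shape, from the hypothesis (TIGHT) in its threshold form:

* `latticeMesh_dense` — the lattice meshes `{s_k z : z ∈ box d L_k}` become dense in every ball when `s_k → 0⁺`
  and `s_k L_k → ∞` (the density hypothesis `hD` of `meshArzelaAscoli_indexed`);
* `seqTight_of_tight` — the threshold form of (TIGHT) (`β ≥ β₅`, `a(β) L ≥ Λ₅`) gives the sequential form along
  any `βs → ∞` with `a(βs k) Ls k → ∞`;
* `latticeKernel_extraction` / `latticeKernel_extraction_of_tight` — `meshArzelaAscoli_indexed` with index set the
  lattice sites, `P k = box d (L k)`, `e k z = s_k z`.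

Pure analysis (no measure); with `g k z = ker (βs k) (Ls k) z` and `tightOfPlaneTight` this is the extraction step
of `PlaneLimitExtraction`; the symmetry, reflection-positivity and `Q2`-convergence clauses are separate modules.
No summit, rung or crux is proved here.
-/

set_option autoImplicit false

noncomputable section

open Filter Topology
open Literature.MathematicalPhysics.QuantumLattice Literature.Probability.LatticeModels

namespace Summit.QuantumFields.YangMills.Cruxes.UniversalDetectorPlaneTight

/-- A point of `ℝ^d` is within `√d · s` of the lattice point below it (spacing `s > 0`). -/
theorem norm_sub_smul_siteToE_floor_le {d : ℕ} {s : ℝ} (hs : 0 < s) (x : EuclideanSpace ℝ (Fin d)) :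
    ‖x - s • siteToE (fun i => ⌊s⁻¹ * x i⌋ : Site d)‖ ≤ Real.sqrt d * s := by
  have hcoord : ∀ i, ‖(x - s • siteToE (fun i => ⌊s⁻¹ * x i⌋ : Site d)) i‖ ^ 2 ≤ s ^ 2 := by
    intro i
    have h0 : ((⌊s⁻¹ * x i⌋ : ℤ) : ℝ) ≤ s⁻¹ * x i := Int.floor_le _
    have h1 : s⁻¹ * x i < ((⌊s⁻¹ * x i⌋ : ℤ) : ℝ) + 1 := Int.lt_floor_add_one _
    have hxi : x i - s * ((⌊s⁻¹ * x i⌋ : ℤ) : ℝ) = s * (s⁻¹ * x i - ((⌊s⁻¹ * x i⌋ : ℤ) : ℝ)) := by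
      field_simp
    have hge : 0 ≤ x i - s * ((⌊s⁻¹ * x i⌋ : ℤ) : ℝ) := by rw [hxi]; exact mul_nonneg hs.le (by linarith)
    have hle : x i - s * ((⌊s⁻¹ * x i⌋ : ℤ) : ℝ) ≤ s := by rw [hxi]; nlinarith
    have : ‖(x - s • siteToE (fun i => ⌊s⁻¹ * x i⌋ : Site d)) i‖ = x i - s * ((⌊s⁻¹ * x i⌋ : ℤ) : ℝ) := by
      rw [PiLp.sub_apply, PiLp.smul_apply, siteToE_apply, smul_eq_mul, Real.norm_of_nonneg hge]
    rw [this]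
    exact pow_le_pow_left₀ hge hle 2
  rw [EuclideanSpace.norm_eq]
  calc Real.sqrt (∑ i, ‖(x - s • siteToE (fun i => ⌊s⁻¹ * x i⌋ : Site d)) i‖ ^ 2)
      ≤ Real.sqrt (∑ _i : Fin d, s ^ 2) := Real.sqrt_le_sqrt (Finset.sum_le_sum fun i _ => hcoord i)
    _ = Real.sqrt d * s := by
        rw [Finset.sum_const, Finset.card_univ, Fintype.card_fin, nsmul_eq_mul,
          Real.sqrt_mul (Nat.cast_nonneg d), Real.sqrt_sq hs.le]

/-- The lattice point below a point of the ball of radius `R` lies in `box d L` once `R ≤ s L`. -/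
theorem floor_mem_box_of_norm_le {d : ℕ} {s R : ℝ} (hs : 0 < s) {L : ℕ} (hRL : R ≤ s * L)
    (x : EuclideanSpace ℝ (Fin d)) (hx : ‖x‖ ≤ R) :
    (fun i => ⌊s⁻¹ * x i⌋ : Site d) ∈ box d L := by
  rw [mem_box]
  intro i
  have hxi : |x i| ≤ R := le_trans (by simpa [Real.norm_eq_abs] using PiLp.norm_apply_le x i) hx
  have h1 := le_abs_self (x i)
  have h2 := neg_abs_le (x i)
  have hup : s⁻¹ * x i ≤ L := by
    rw [inv_mul_le_iff₀ hs]; linarith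
  have hlo : -(L : ℝ) ≤ s⁻¹ * x i := by
    rw [le_inv_mul_iff₀ hs]; linarith
  refine ⟨Int.le_floor.2 (by exact_mod_cast hlo), Int.floor_le_iff.2 (by push_cast; linarith)⟩

/-- **Lattice meshes become dense in every ball.**  If `s_k → 0⁺` and `s_k L_k → ∞` then for all `δ, R > 0`,
eventually every point of the ball of radius `R` is within `δ` of a lattice point `s_k z`, `z ∈ box d L_k`
(the hypothesis `hD` of `meshArzelaAscoli_indexed` for the lattice meshes). -/
theorem latticeMesh_dense {d : ℕ} (s : ℕ → ℝ) (L : ℕ → ℕ) (hs : ∀ k, 0 < s k)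
    (hs0 : Tendsto s atTop (𝓝 0)) (hL : Tendsto (fun k => s k * L k) atTop atTop) :
    ∀ δ R : ℝ, 0 < δ → 0 < R → ∃ k₀ : ℕ, ∀ k, k₀ ≤ k →
      ∀ x : EuclideanSpace ℝ (Fin d), ‖x‖ ≤ R → ∃ z ∈ (box d (L k) : Set (Site d)), ‖x - s k • siteToE z‖ ≤ δ := by
  intro δ R hδ hR
  have h1 : ∀ᶠ k in atTop, Real.sqrt d * s k ≤ δ := by
    have ht : Tendsto (fun k => Real.sqrt d * s k) atTop (𝓝 0) := by
      simpa using hs0.const_mul (Real.sqrt d)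
    exact ht.eventually (eventually_le_nhds hδ)
  have h2 : ∀ᶠ k in atTop, R ≤ s k * L k := hL.eventually_ge_atTop R
  obtain ⟨k₀, hk₀⟩ := eventually_atTop.1 (h1.and h2)
  refine ⟨k₀, fun k hk x hx => ⟨fun i => ⌊(s k)⁻¹ * x i⌋, ?_, ?_⟩⟩
  · exact Finset.mem_coe.2 (floor_mem_box_of_norm_le (hs k) (hk₀ k hk).2 x hx)
  · exact (norm_sub_smul_siteToE_floor_le (hs k) x).trans (hk₀ k hk).1

/-- **Threshold tightness ⇒ sequential tightness.**  The threshold form of (TIGHT) (`β ≥ β₅`, `a(β)·L ≥ Λ₅`)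
gives the sequential form along any `βs → ∞` with `a(βs k) · Ls k → ∞`. -/
theorem seqTight_of_tight {d : ℕ} (a : ℝ → ℝ) (g : ℝ → ℕ → Site d → ℝ) (βs : ℕ → ℝ) (Ls : ℕ → ℕ)
    (hβ : Tendsto βs atTop atTop) (hL : Tendsto (fun k => a (βs k) * Ls k) atTop atTop)
    (hT : ∀ η : ℝ, 0 < η → ∃ (C β₅ Λ₅ : ℝ) (ω : ℝ → ℝ), Tendsto ω (𝓝[>] 0) (𝓝 0) ∧
      ∀ β : ℝ, β₅ ≤ β → ∀ L : ℕ, Λ₅ ≤ a β * L → ∀ z ∈ box d L, η ≤ ‖a β • siteToE z‖ →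
        |g β L z| ≤ C ∧ ∀ z' ∈ box d L, η ≤ ‖a β • siteToE z'‖ →
          |g β L z - g β L z'| ≤ ω ‖a β • siteToE z - a β • siteToE z'‖) :
    ∀ η : ℝ, 0 < η → ∃ (C : ℝ) (ω : ℝ → ℝ) (k₀ : ℕ), Tendsto ω (𝓝[>] 0) (𝓝 0) ∧
      ∀ k, k₀ ≤ k → ∀ z ∈ (box d (Ls k) : Set (Site d)), η ≤ ‖a (βs k) • siteToE z‖ →
        |g (βs k) (Ls k) z| ≤ C ∧ ∀ z' ∈ (box d (Ls k) : Set (Site d)), η ≤ ‖a (βs k) • siteToE z'‖ →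
          |g (βs k) (Ls k) z - g (βs k) (Ls k) z'| ≤ ω ‖a (βs k) • siteToE z - a (βs k) • siteToE z'‖ := by
  intro η hη
  obtain ⟨C, β₅, Λ₅, ω, hω, h⟩ := hT η hη
  obtain ⟨k₀, hk₀⟩ := eventually_atTop.1 ((hβ.eventually_ge_atTop β₅).and (hL.eventually_ge_atTop Λ₅))
  refine ⟨C, ω, k₀, hω, fun k hk z hz hzη => ?_⟩
  obtain ⟨h1, h2⟩ := h (βs k) (hk₀ k hk).1 (Ls k) (hk₀ k hk).2 z (Finset.mem_coe.1 hz) hzη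
  exact ⟨h1, fun z' hz' hz'η => h2 z' (Finset.mem_coe.1 hz') hz'η⟩

/-- **Diagonal extraction of a continuum kernel from tight lattice kernels** (lattice form of
`meshArzelaAscoli_indexed`).  Spacings `s_k → 0⁺` with `s_k L_k → ∞`; lattice kernels `g k` on `box d L_k`, uniformly
bounded and uniformly equicontinuous in physical units away from the origin (sequential form).  Then along a
subsequence the kernels converge locally uniformly on every annulus `η ≤ ‖·‖ ≤ η⁻¹` to a kernel `K` continuous off
the origin and bounded away from it. -/
theorem latticeKernel_extraction {d : ℕ} (s : ℕ → ℝ) (L : ℕ → ℕ) (g : ℕ → Site d → ℝ) (hs : ∀ k, 0 < s k)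
    (hs0 : Tendsto s atTop (𝓝 0)) (hL : Tendsto (fun k => s k * L k) atTop atTop)
    (hT : ∀ η : ℝ, 0 < η → ∃ (C : ℝ) (ω : ℝ → ℝ) (k₀ : ℕ), Tendsto ω (𝓝[>] 0) (𝓝 0) ∧
      ∀ k, k₀ ≤ k → ∀ z ∈ (box d (L k) : Set (Site d)), η ≤ ‖s k • siteToE z‖ →
        |g k z| ≤ C ∧ ∀ z' ∈ (box d (L k) : Set (Site d)), η ≤ ‖s k • siteToE z'‖ →
          |g k z - g k z'| ≤ ω ‖s k • siteToE z - s k • siteToE z'‖) :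
    ∃ (φ : ℕ → ℕ) (K : EuclideanSpace ℝ (Fin d) → ℝ), StrictMono φ ∧
      (∀ η ε : ℝ, 0 < η → 0 < ε → ∃ k₀ : ℕ, ∀ k : ℕ, k₀ ≤ k → ∀ z ∈ box d (L (φ k)),
        η ≤ ‖s (φ k) • siteToE z‖ → ‖s (φ k) • siteToE z‖ ≤ η⁻¹ →
          |g (φ k) z - K (s (φ k) • siteToE z)| ≤ ε) ∧
      ContinuousOn K {z | z ≠ 0} ∧
      (∀ η : ℝ, 0 < η → ∃ C : ℝ, ∀ z : EuclideanSpace ℝ (Fin d), η ≤ ‖z‖ → |K z| ≤ C) := by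
  have he : ∀ k, Set.InjOn (fun z : Site d => s k • siteToE z) (box d (L k) : Set (Site d)) := by
    intro k z _ z' _ hzz'
    have h := congrArg (fun v => (s k)⁻¹ • v) hzz'
    simp only [smul_smul, inv_mul_cancel₀ (hs k).ne', one_smul] at h
    funext i
    have hi := congrArg (fun v : EuclideanSpace ℝ (Fin d) => v i) h
    simpa [siteToE_apply] using hi
  obtain ⟨φ, K, hφ, happ, hcont, hbd⟩ :=
    Summit.QuantumFields.YangMills.Cruxes.UniversalDetectorLimitExtraction.meshArzelaAscoli_indexed d
      (fun k => (box d (L k) : Set (Site d))) (fun k z => s k • siteToE z) g he hT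
      (latticeMesh_dense s L hs hs0 hL)
  exact ⟨φ, K, hφ, fun η ε hη hε => by
    obtain ⟨k₀, hk₀⟩ := happ η ε hη hε
    exact ⟨k₀, fun k hk z hz h1 h2 => hk₀ k hk z (Finset.mem_coe.2 hz) h1 h2⟩, hcont, hbd⟩

/-- **Extraction from the threshold form of (TIGHT).**  For a lattice spacing `a(β) → 0⁺`, kernels `g β L` on
`box d L` satisfying (TIGHT) in threshold form, and sequences `βs → ∞`, `a(βs k) Ls k → ∞`: a subsequence and a
limit kernel with the three extraction clauses of `PlaneLimitExtraction`. -/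
theorem latticeKernel_extraction_of_tight {d : ℕ} (a : ℝ → ℝ) (g : ℝ → ℕ → Site d → ℝ) (ha : ∀ β, 0 < a β)
    (ha0 : Tendsto a atTop (𝓝 0))
    (hT : ∀ η : ℝ, 0 < η → ∃ (C β₅ Λ₅ : ℝ) (ω : ℝ → ℝ), Tendsto ω (𝓝[>] 0) (𝓝 0) ∧
      ∀ β : ℝ, β₅ ≤ β → ∀ L : ℕ, Λ₅ ≤ a β * L → ∀ z ∈ box d L, η ≤ ‖a β • siteToE z‖ →
        |g β L z| ≤ C ∧ ∀ z' ∈ box d L, η ≤ ‖a β • siteToE z'‖ →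
          |g β L z - g β L z'| ≤ ω ‖a β • siteToE z - a β • siteToE z'‖)
    (βs : ℕ → ℝ) (Ls : ℕ → ℕ) (hβ : Tendsto βs atTop atTop)
    (hL : Tendsto (fun k => a (βs k) * Ls k) atTop atTop) :
    ∃ (φ : ℕ → ℕ) (K : EuclideanSpace ℝ (Fin d) → ℝ), StrictMono φ ∧
      (∀ η ε : ℝ, 0 < η → 0 < ε → ∃ k₀ : ℕ, ∀ k : ℕ, k₀ ≤ k → ∀ z ∈ box d (Ls (φ k)),
        η ≤ ‖a (βs (φ k)) • siteToE z‖ → ‖a (βs (φ k)) • siteToE z‖ ≤ η⁻¹ →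
          |g (βs (φ k)) (Ls (φ k)) z - K (a (βs (φ k)) • siteToE z)| ≤ ε) ∧
      ContinuousOn K {z | z ≠ 0} ∧
      (∀ η : ℝ, 0 < η → ∃ C : ℝ, ∀ z : EuclideanSpace ℝ (Fin d), η ≤ ‖z‖ → |K z| ≤ C) :=
  latticeKernel_extraction (fun k => a (βs k)) Ls (fun k => g (βs k) (Ls k)) (fun k => ha (βs k))
    (ha0.comp hβ) hL (seqTight_of_tight a g βs Ls hβ hL hT)

end Summit.QuantumFields.YangMills.Cruxes.UniversalDetectorPlaneTight

end
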